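import Summits.Schanuel.Schanuel.Theorems.ZilberEacParamCurveRayRoots
import Summits.Schanuel.Schanuel.Theorems.ZilberEacGraphSurfaceLogRootSeq
import HarnessLib

/-!
# Polynomially parametrised base curves, XV: logarithmically corrected roots ON the ray
# (towards UNBALANCED edges over a polynomial curve)

HONEST FRAMING.  Cell `pub-schanuel` (Zilber's Exponential-Algebraic Closedness, case ladder;
host summit Schanuel), seat 2, gen 19.  For an UNBALANCED lower-left edge of `Q(t; y₀, y₁)`
(a single monomial of top `t`-degree on the edge) the escape must balance the edge monomials at
`e^{R(t)} ≍ t^{μ}`, i.e. along exact roots of `R(z) - μ log z = 2πi N + c₀` (gen 17,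
`exists_alRoot_log`).  This file is the directional version: the root `z₀ = (k+1) ω e^{ζ/d}` lies
ON the root direction `ω` with `‖ζ‖ ≤ C₁(k)/(π(k+1))`, `C₁(k) = C₁ + |μ|(log((k+1)‖ω‖) + 5)`
(so `ζ → 0`), and no hypothesis on `Re ω` is made (`exists_alRoot_log_dir`); packaged with the
growth of a second polynomial `G` along the roots as `exists_ray_roots_log` (file XVI).  The density
theorems built on this are instances of Mantova–Masser's OPEN question (PLMS 2024, §1 p. 5); NOT
Schanuel's conjecture (neither used nor implied; EAC ⇏ SC); `EC(3,2)` stays OPEN.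
-/

noncomputable section

open Filter Topology Metric Set Complex Polynomial
open Literature.ModelTheory.Zilber

set_option linter.dupNamespace false

namespace Summit.Schanuel.Schanuel.Theorems

/-- **Stage `k`: an exact root ON the ray of the logarithmically corrected equation.**
`deg r = d ≥ 2`, `lc(r) ω^d = 2πi s`, `μ ∈ ℝ`, `1 ≤ (k+1)‖ω‖`, and the size hypothesis
`32 C₁(k) ≤ 2π(k+1)` with `C₁(k) = Σ‖ℓᵢ‖(3‖ω‖+1)^{d-1} + ‖c₀‖ + |μ|(log((k+1)‖ω‖) + 5)`.  Then for
some `ζ` with `‖ζ‖ ≤ 1/2` and `‖ζ‖ ≤ C₁(k)/(π(k+1))` and some logarithm `L` of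
`z₀ = (k+1) ω e^{ζ/d}`: `r(z₀) = (k+1)^d s · 2πi + c₀ + μ L`. (new) -/
theorem exists_alRoot_log_dir (r : Polynomial ℂ) (hd : 2 ≤ r.natDegree) (ω : ℂ) (s : ℤ)
    (hs : s = 1 ∨ s = -1) (hω : r.leadingCoeff * ω ^ r.natDegree = 2 * Real.pi * I * s)
    (μ : ℝ) (c₀ : ℂ) (k : ℕ) (hk1 : 1 ≤ ((k : ℝ) + 1) * ‖ω‖)
    (hk : 32 * (coeffNormSum r.eraseLead * (3 * ‖ω‖ + 1) ^ (r.natDegree - 1) + ‖c₀‖ +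
      |μ| * (Real.log (((k : ℝ) + 1) * ‖ω‖) + 5)) ≤ 2 * Real.pi * ((k : ℝ) + 1)) :
    ∃ ζ L : ℂ, ‖ζ‖ ≤ 1 / 2 ∧
      ‖ζ‖ ≤ (coeffNormSum r.eraseLead * (3 * ‖ω‖ + 1) ^ (r.natDegree - 1) + ‖c₀‖ +
        |μ| * (Real.log (((k : ℝ) + 1) * ‖ω‖) + 5)) / (Real.pi * ((k : ℝ) + 1)) ∧
      exp L = ((k : ℂ) + 1) * ω * exp (ζ / r.natDegree) ∧
      r.eval (((k : ℂ) + 1) * ω * exp (ζ / r.natDegree)) =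
        (((k + 1) ^ r.natDegree * s : ℤ) : ℂ) * (2 * Real.pi * I) + c₀ + μ * L := by
  set d : ℕ := r.natDegree with hd_def
  set a : ℂ := r.leadingCoeff with ha_def
  set ℓ : Polynomial ℂ := r.eraseLead with hℓ_def
  set C₁ : ℝ := coeffNormSum ℓ * (3 * ‖ω‖ + 1) ^ (d - 1) + ‖c₀‖ +
    |μ| * (Real.log (((k : ℝ) + 1) * ‖ω‖) + 5) with hC₁
  have hd1 : 1 ≤ d := le_trans (by norm_num) hd
  have hk0 : (0 : ℝ) ≤ (k : ℝ) := Nat.cast_nonneg k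
  have hkpos : (0 : ℝ) < (k : ℝ) + 1 := by linarith
  have hsn : ‖(s : ℂ)‖ = 1 := by rcases hs with rfl | rfl <;> simp
  set z₁ : ℂ := ((k : ℂ) + 1) * ω with hz₁
  have hz₁norm : ‖z₁‖ = ((k : ℝ) + 1) * ‖ω‖ := by rw [hz₁, norm_mul, norm_natCast_add_one]
  have hz₁1 : 1 ≤ ‖z₁‖ := by rw [hz₁norm]; exact hk1
  have hz₁0 : z₁ ≠ 0 := norm_pos_iff.1 (by linarith)
  set L₁ : ℂ := Complex.log z₁ with hL₁
  have hL₁exp : exp L₁ = z₁ := Complex.exp_log hz₁0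
  have hL₁norm : ‖L₁‖ ≤ Real.log (((k : ℝ) + 1) * ‖ω‖) + Real.pi := by
    rw [← hz₁norm]; exact norm_log_le_of_one_le hz₁1
  set T : ℂ := (((k + 1) ^ d * s : ℤ) : ℂ) * (2 * Real.pi * I) with hT_def
  have hT : a * z₁ ^ d = T := by
    have : a * z₁ ^ d = ((k : ℂ) + 1) ^ d * (a * ω ^ d) := by rw [hz₁, mul_pow]; ring
    rw [this, hω, hT_def]; push_cast; ring
  have hTnorm : ‖T‖ = 2 * Real.pi * ((k : ℝ) + 1) ^ d := by
    rw [← hT, norm_mul, norm_pow, hz₁norm, mul_pow]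
    have hsabs : |(s : ℝ)| = 1 := by rcases hs with rfl | rfl <;> simp
    have haω : ‖a‖ * ‖ω‖ ^ d = 2 * Real.pi := by
      rw [← norm_pow, ← norm_mul, hω]
      simp [hsabs, Complex.norm_real, Real.norm_eq_abs, abs_of_pos Real.pi_pos]
    calc ‖a‖ * (((k : ℝ) + 1) ^ d * ‖ω‖ ^ d) = (‖a‖ * ‖ω‖ ^ d) * ((k : ℝ) + 1) ^ d := by ring
      _ = 2 * Real.pi * ((k : ℝ) + 1) ^ d := by rw [haω]
  have hTpos : 0 < ‖T‖ := by rw [hTnorm]; positivity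
  have hT0 : T ≠ 0 := norm_pos_iff.mp hTpos
  have hpow : ((k : ℝ) + 1) ^ d = ((k : ℝ) + 1) * ((k : ℝ) + 1) ^ (d - 1) := by
    rw [← pow_succ', Nat.sub_add_cancel hd1]
  -- the analytic target
  set ψ : ℂ → ℂ := fun ζ => c₀ + (μ : ℂ) * (L₁ + ζ / d) with hψ_def
  have hψd : DifferentiableOn ℂ ψ (Metric.ball 0 1) :=
    ((differentiable_const _).add ((differentiable_const _).mul
      ((differentiable_const _).add (differentiable_id.div_const _)))).differentiableOn
  have hψn : ∀ ζ : ℂ, ‖ζ‖ < 1 →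
      ‖ψ ζ‖ ≤ ‖c₀‖ + |μ| * (Real.log (((k : ℝ) + 1) * ‖ω‖) + 5) := by
    intro ζ hζ
    have hx : ‖ζ / (d : ℂ)‖ ≤ 1 := by
      rw [norm_div, Complex.norm_natCast]
      exact (div_le_self (norm_nonneg _) (by exact_mod_cast hd1)).trans hζ.le
    have h1 : ‖L₁ + ζ / d‖ ≤ Real.log (((k : ℝ) + 1) * ‖ω‖) + 5 := by
      have := norm_add_le L₁ (ζ / d)
      have hπ := Real.pi_lt_four
      linarith
    calc ‖ψ ζ‖ ≤ ‖c₀‖ + ‖(μ : ℂ) * (L₁ + ζ / d)‖ := norm_add_le _ _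
      _ = ‖c₀‖ + |μ| * ‖L₁ + ζ / d‖ := by
          rw [norm_mul, Complex.norm_real, Real.norm_eq_abs]
      _ ≤ ‖c₀‖ + |μ| * (Real.log (((k : ℝ) + 1) * ‖ω‖) + 5) := by
          gcongr
  -- the lower-order part against the target on the disc
  have hbound : ∀ ζ : ℂ, ‖ζ‖ < 1 → ‖ℓ.eval (z₁ * exp (ζ / d)) - ψ ζ‖ ≤
      C₁ * ((k : ℝ) + 1) ^ (d - 1) := by
    intro ζ hζ
    have h2 := norm_eraseLead_eval_ray_sub_le r hd1 ω 0 k hζ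
    rw [← hd_def, ← hℓ_def, sub_zero, norm_zero, add_zero, ← hz₁] at h2
    have hkpow : (1 : ℝ) ≤ ((k : ℝ) + 1) ^ (d - 1) := one_le_pow₀ (by linarith)
    have hψ0 : 0 ≤ ‖c₀‖ + |μ| * (Real.log (((k : ℝ) + 1) * ‖ω‖) + 5) := by
      have := Real.log_nonneg hk1
      positivity
    calc ‖ℓ.eval (z₁ * exp (ζ / d)) - ψ ζ‖
        ≤ ‖ℓ.eval (z₁ * exp (ζ / d))‖ + ‖ψ ζ‖ := norm_sub_le _ _
      _ ≤ coeffNormSum ℓ * (3 * ‖ω‖ + 1) ^ (d - 1) * ((k : ℝ) + 1) ^ (d - 1) +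
            (‖c₀‖ + |μ| * (Real.log (((k : ℝ) + 1) * ‖ω‖) + 5)) * ((k : ℝ) + 1) ^ (d - 1) := by
          refine add_le_add h2 ?_
          exact (hψn ζ hζ).trans (le_mul_of_one_le_right hψ0 hkpow)
      _ = C₁ * ((k : ℝ) + 1) ^ (d - 1) := by rw [hC₁]; ring
  have hsmall : ∀ ζ : ℂ, ‖ζ‖ < 1 → ‖ℓ.eval (z₁ * exp (ζ / d)) - ψ ζ‖ ≤ ‖T‖ / 32 := by
    intro ζ hζ
    refine (hbound ζ hζ).trans ?_
    rw [hTnorm, le_div_iff₀ (by norm_num : (0 : ℝ) < 32), hpow]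
    have h0 : (0 : ℝ) ≤ ((k : ℝ) + 1) ^ (d - 1) := by positivity
    have hk' : 32 * C₁ ≤ 2 * Real.pi * ((k : ℝ) + 1) := by rw [hC₁]; exact hk
    nlinarith
  obtain ⟨ζ, hζ, hroot⟩ := exists_polyRoot_mul_exp_fun r (by omega) z₁ T ψ hψd hT hT0 hsmall
  have hζ1 : ‖ζ‖ < 1 := by linarith
  have hdC : (d : ℂ) ≠ 0 := Nat.cast_ne_zero.mpr (by omega)
  -- direction control: `T (e^ζ - 1) = ψ ζ - ℓ(z₀)`
  have hlead : a * (z₁ * exp (ζ / d)) ^ d = T * exp ζ := by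
    rw [mul_pow, ← Complex.exp_nat_mul, mul_div_cancel₀ _ hdC, ← mul_assoc, hT]
  have hkey : T * (exp ζ - 1) = ψ ζ - ℓ.eval (z₁ * exp (ζ / d)) := by
    have h1 := eval_eq_eraseLead_add r (z₁ * exp (ζ / d))
    rw [hroot, ← hℓ_def, ← ha_def, ← hd_def, hlead] at h1
    linear_combination -h1
  have hC₁0 : 0 ≤ C₁ := by
    have := coeffNormSum_nonneg ℓ
    have := Real.log_nonneg hk1
    positivity
  have hexp1 : ‖exp ζ - 1‖ ≤ C₁ / (2 * Real.pi * ((k : ℝ) + 1)) := by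
    have h1 : ‖T‖ * ‖exp ζ - 1‖ ≤ C₁ * ((k : ℝ) + 1) ^ (d - 1) := by
      rw [← norm_mul, hkey, norm_sub_rev]
      exact hbound ζ hζ1
    rw [hTnorm, hpow] at h1
    rw [le_div_iff₀ (by positivity)]
    have h0 : (0 : ℝ) < ((k : ℝ) + 1) ^ (d - 1) := by positivity
    nlinarith [norm_nonneg (exp ζ - 1)]
  have hζsq : ‖ζ‖ ≤ ‖exp ζ - 1‖ + ‖ζ‖ * (1 / 2) := by
    have h1 : ‖exp ζ - 1 - ζ‖ ≤ ‖ζ‖ ^ 2 := Complex.norm_exp_sub_one_sub_id_le hζ1.le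
    have h2 : ‖ζ‖ ≤ ‖exp ζ - 1‖ + ‖exp ζ - 1 - ζ‖ := by
      have := norm_sub_le (exp ζ - 1) (exp ζ - 1 - ζ)
      rwa [sub_sub_cancel] at this
    have h3 : ‖ζ‖ ^ 2 ≤ ‖ζ‖ * (1 / 2) := by
      rw [pow_two]; exact mul_le_mul_of_nonneg_left hζ (norm_nonneg _)
    linarith
  refine ⟨ζ, L₁ + ζ / d, hζ, ?_, ?_, ?_⟩
  · have : ‖ζ‖ ≤ 2 * (C₁ / (2 * Real.pi * ((k : ℝ) + 1))) := by linarith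
    calc ‖ζ‖ ≤ 2 * (C₁ / (2 * Real.pi * ((k : ℝ) + 1))) := this
      _ = C₁ / (Real.pi * ((k : ℝ) + 1)) := by
          have hπ := Real.pi_pos.ne'
          field_simp
  · rw [Complex.exp_add, hL₁exp, hz₁]
  · rw [← hd_def] at hroot
    rw [hroot, hψ_def]
    ring

end Summit.Schanuel.Schanuel.Theorems
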